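/-
Copyright: the b2b-balaban T⁴-continuum CRUX team, row NE7b OWNER lineage `t4-ne7b-p1` (gen 144). Project licence.
-/
import Summits.QuantumFields.BalabanUV.T4Continuum.Spine.NE7b.SupFifthKernelSlotMasters
import Summits.QuantumFields.BalabanUV.T4Continuum.Spine.NE7b.SupFifthKernelSlotSupportSums
import Summits.QuantumFields.BalabanUV.T4Continuum.Spine.NE7b.SupFivePointThresholdSlotSums
import Summits.QuantumFields.BalabanUV.T4Continuum.Spine.NE7b.SupFifthKernelSums
import Summits.QuantumFields.BalabanUV.T4Continuum.Spine.NE7b.SupFifthKernelSlotTools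
import Summits.QuantumFields.BalabanUV.T4Continuum.Spine.NE7b.SupKernelClassThirdLetters
import Summits.QuantumFields.BalabanUV.T4Continuum.Spine.NE7b.SupWhitenedHessianGradientCovariance

/-!
# THE SLOT LETTER `k5s3⁺` OF THE ORDER-FIVE ENTRY MAJORANT, BLOCK FOUR, FIRST HALF (twelve terms: supported centred triples and `u₄` trees) (display index `t` fixed, row index
# summed; the order-5 block of the kernel-letter CLASS MAP; finite sums).  (610)'s majorant is six group blocks of 52 written-out terms; this
# file sums the named block(s) over the other three display indices and `x` with `t` fixed — two-point terms by (613)'s masters (MASS letter of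
# the family containing `t`, COLUMN letter of the other), supported stars∕trees by (614) with the `Hk`∕`K3` supports counted in the role the term
# dictates, the threshold by (558); reindexed by (595)∕(613).  NEW INPUT LETTERS: `k5s2, k5s3, k5s4, k3m`, the support counts in all roles
# (`hn, hn′`; `hn3, hn3f, hn3m`) (row NE7b, node U5c; (613), (614), (527), (558), (564), (595), (611) BY NAME; [folklore] finite sums)

Cell `pub-balaban`, sub-cell `t4`, spine estimate NE7b (`T4WeightBudget.RelWeightBound`; the cell's OWN estimate — NOT PRINTED in
[Bałaban 1983–89], NOT PROVED).  Crux-route work under `Spine/NE7b/` by the row OWNER (`t4-ne7b-p1` gen 144, file (626)) under FREEZE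
(0)'s crux-prover clause; NOTHING of Bałaban's is named as a Lean object, valued or asserted; no `T4Continuum/Support` leaf typed; no
`def`, no notation (the majorant blocks WRITTEN OUT as in (610)); zero `sorry`.  Imports (BY NAME): the OWNER's (613), (614), (558), (595), (611), (483), (480).

WHAT IS PROVED ([folklore]): `slot_t_kappa3B`; toy.

HONEST (what this is NOT).  Finite sums over blocks of (610)'s majorant; the slot letter itself (the six blocks added) is the END file; only the
non-negativity of `C3k, C3h, C4, C5` is hypothesised.  Scalar skeleton ((A3), NC-NE7b-α UNRULED); nothing of Bałaban's asserted.
BY-NAME EFFECT ON THE WALL: NONE.  NE7b NOT PRINTED ∕ NOT PROVED; spine PROVED 0∕9; rung (B)+1 — the programme's measures remain FINITE-torus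
statements; NOT the mass gap, NOT Clay.  HONEST DEPENDENCY: continuum YM on T⁴ ⇐ BetaPertH ∧ nine spine estimates (0∕9 proved); BetaPertH ⇐
(D1) ∧ (D4) ∧ CAP+tail; G-an2-4 gates asym, D1 and NE2∕3∕4.
-/

set_option autoImplicit false

noncomputable section

namespace Summit.QuantumFields.BalabanUV.T4Continuum.NE7b.SupFifthKernelEntryLetterSlotFourB

open Finset Real Matrix
open scoped BigOperators
open SupFourthKernelSlotSums (third_vector_mass_two third_vector_mass_three tree16_sum_slot_two tree16_sum_slot_three tree16_sum_slot_four)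
open SupFifthKernelSlotMasters (fourth_vector_mass_two fourth_vector_mass_three fourth_vector_mass_four master31 master31_rev master22 master22_rev
  master13 master13_rev master04 master04_rev sum4_ystz sum4_zsty sum4_tzys sum4_tszy sum4_szyt sum4_styz sum4_stzy)
open SupFifthKernelSlotSupportSums (pair_vertex_leg_fixed pair_vertex_member_fixed pair_counted_leg_fn pair_leg_otherleg_fixed vertex_rider_fixed
  two_riders_leg_fixed counted_then_riders_leg_fn leg_rider_leg_fn tree_rider_fixed tree_leaf_fixed_vertex_riders tree_counted_weight
  tree_leaf_fixed_leaf_rider)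
open SupFourPointTreeRowSum (tree_sum_row_le)
open SupFivePointThresholdSlotSums (threshold_pow4_slot_2 threshold_pow4_slot_3 threshold_pow4_slot_4 threshold_pow4_slot_5)
open SupFifthKernelSums (sum4_ytsz sum4_zyts sum4_yzst sum4_tyzs sum4_syzt sum4_ztsy sum4_tsyz sum4_ytzs sum4_zsyt sum4_yszt sum4_ztys sum4_sytz
  sum4_zyst sum4_tysz sum4_szty sum4_tzsy)
open SupFifthKernelSlotTools (sum4_le_abs abs_ite_le abs_ite_ite_le sum4_add const_mul_sum4_le)
open SupFifthKernelTwoPointLetters (fourth_vector_nonneg fourth_vector_mass_le fourth_vector_colsum_le)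
open SupFourthKernelTwoPointLetters (third_vector_nonneg third_vector_mass_le third_vector_colsum_le)
open SupHessianVectorGeometryLetters (hess_vector_nonneg)
open SupWhitenedHessianGradientCovariance (hessian_obs_mass_le)
open SupKernelClassThirdLetters (hessian_obs_mass_second hessian_obs_colsum)
open SupWhitenedFirstOrderLetters (whitened_obs_nonneg whitened_obs_rowsum_le whitened_obs_colsum_le)

variable {ι κ : Type} [Fintype ι] [DecidableEq ι] [Fintype κ] [DecidableEq κ]

variable {Hk : ι → ι → ℝ} {K3 : ι → ι → ι → ℝ} {K4 : ι → ι → ι → ι → ℝ} {K5 : ι → ι → ι → ι → ι → ℝ} {A : Matrix ι κ ℝ} {D : κ → κ → ℝ}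
  {lamA αr αc hr hc k3r k3m k3c k4r k4s2 k4s3 k4c k5r k5s2 k5s3 k5s4 k5c dr dc S S' S₁ n₃ C3k C3h C4 C5 : ℝ} {ρ r : ι → ι → ℝ} {n : ℕ}

omit [DecidableEq ι] [Fintype κ] [DecidableEq κ] in
set_option maxHeartbeats 3000000 in
set_option maxRecDepth 4096 in
/-- The `kappa3B` block of (610)'s majorant summed with the display index `t` fixed (12 terms). [folklore] -/
theorem slot_t_kappa3B
    (hρ1 : ∀ x y, 1 ≤ ρ x y) (hρsymm : ∀ x y, ρ x y = ρ y x) (hS : ∀ u, ∑ v, 1 / ρ u v ≤ S) (hrs : ∀ u v, r u v = r v u)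
    (hSr : ∀ u, ∑ v, (r u v ^ 2)⁻¹ ≤ S') (hn : ∀ y : ι, (Finset.univ.filter (fun z => Hk z y ≠ 0)).card ≤ n)
    (hn' : ∀ z : ι, (Finset.univ.filter (fun y => Hk z y ≠ 0)).card ≤ n)
    (hn3 : ∀ y : ι, ∑ z, ((Finset.univ.filter (fun t => K3 z t y ≠ 0)).card : ℝ) ≤ n₃)
    (hn3m : ∀ b : ι, ∑ a, ((Finset.univ.filter (fun c => K3 a b c ≠ 0)).card : ℝ) ≤ n₃) (hC3k0 : 0 ≤ C3k) (hC3h0 : 0 ≤ C3h) (hC40 : 0 ≤ C4) (t : ι) :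
    ∑ y, ∑ z, ∑ s, ∑ x, ((if K3 y z x = 0 then 0 else C3k / (ρ x t * ρ x s) : ℝ) + (if Hk t x = 0 then 0 else if Hk z y = 0 then 0 else C3h / (ρ x y * ρ x s) : ℝ) + (if Hk s x = 0 then 0 else if Hk z y = 0 then 0 else C3h / (ρ x y * ρ x t) : ℝ) + (if Hk z y = 0 then 0 else C4 * (((r x y ^ 2)⁻¹ * (r x t ^ 2)⁻¹ * (r x s ^ 2)⁻¹ + (r x y ^ 2)⁻¹ * (r y t ^ 2)⁻¹ * (r y s ^ 2)⁻¹ + (r x t ^ 2)⁻¹ * (r y t ^ 2)⁻¹ * (r t s ^ 2)⁻¹ + (r x s ^ 2)⁻¹ * (r y s ^ 2)⁻¹ * (r t s ^ 2)⁻¹ + (r x y ^ 2)⁻¹ * (r y t ^ 2)⁻¹ * (r t s ^ 2)⁻¹ + (r x y ^ 2)⁻¹ * (r y s ^ 2)⁻¹ * (r t s ^ 2)⁻¹ + (r x t ^ 2)⁻¹ * (r y t ^ 2)⁻¹ * (r y s ^ 2)⁻¹ + (r x t ^ 2)⁻¹ * (r y s ^ 2)⁻¹ * (r t s ^ 2)⁻¹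 + (r x s ^ 2)⁻¹ * (r y t ^ 2)⁻¹ * (r y s ^ 2)⁻¹ + (r x s ^ 2)⁻¹ * (r y t ^ 2)⁻¹ * (r t s ^ 2)⁻¹ + (r x y ^ 2)⁻¹ * (r x t ^ 2)⁻¹ * (r t s ^ 2)⁻¹ + (r x y ^ 2)⁻¹ * (r x s ^ 2)⁻¹ * (r t s ^ 2)⁻¹ + (r x y ^ 2)⁻¹ * (r x t ^ 2)⁻¹ * (r y s ^ 2)⁻¹ + (r x t ^ 2)⁻¹ * (r x s ^ 2)⁻¹ * (r y s ^ 2)⁻¹ + (r x y ^ 2)⁻¹ * (r x s ^ 2)⁻¹ * (r y t ^ 2)⁻¹ + (r x t ^ 2)⁻¹ * (r x s ^ 2)⁻¹ * (r y t ^ 2)⁻¹)) : ℝ) + (if K3 y t x = 0 then 0 else C3k / (ρ x z * ρ x s) : ℝ) + (if Hk z x = 0 then 0 else if Hk t y = 0 then 0 else C3h / (ρ x y * ρ x s) : ℝ) + (if Hk s x = 0 then 0 else if Hk t y = 0 then 0 else C3h / (ρ x y * ρ x z) : ℝ) + (if Hk t y = 0 then 0 else C4 * (((r x y ^ 2)⁻¹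 * (r x z ^ 2)⁻¹ * (r x s ^ 2)⁻¹ + (r x y ^ 2)⁻¹ * (r y z ^ 2)⁻¹ * (r y s ^ 2)⁻¹ + (r x z ^ 2)⁻¹ * (r y z ^ 2)⁻¹ * (r z s ^ 2)⁻¹ + (r x s ^ 2)⁻¹ * (r y s ^ 2)⁻¹ * (r z s ^ 2)⁻¹ + (r x y ^ 2)⁻¹ * (r y z ^ 2)⁻¹ * (r z s ^ 2)⁻¹ + (r x y ^ 2)⁻¹ * (r y s ^ 2)⁻¹ * (r z s ^ 2)⁻¹ + (r x z ^ 2)⁻¹ * (r y z ^ 2)⁻¹ * (r y s ^ 2)⁻¹ + (r x z ^ 2)⁻¹ * (r y s ^ 2)⁻¹ * (r z s ^ 2)⁻¹ + (r x s ^ 2)⁻¹ * (r y z ^ 2)⁻¹ * (r y s ^ 2)⁻¹ + (r x s ^ 2)⁻¹ * (r y z ^ 2)⁻¹ * (r z s ^ 2)⁻¹ + (r x y ^ 2)⁻¹ * (r x z ^ 2)⁻¹ * (r z s ^ 2)⁻¹ + (r x y ^ 2)⁻¹ * (r x s ^ 2)⁻¹ * (r z s ^ 2)⁻¹ + (r x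 y ^ 2)⁻¹ * (r x z ^ 2)⁻¹ * (r y s ^ 2)⁻¹ + (r x z ^ 2)⁻¹ * (r x s ^ 2)⁻¹ * (r y s ^ 2)⁻¹ + (r x y ^ 2)⁻¹ * (r x s ^ 2)⁻¹ * (r y z ^ 2)⁻¹ + (r x z ^ 2)⁻¹ * (r x s ^ 2)⁻¹ * (r y z ^ 2)⁻¹)) : ℝ) + (if K3 y s x = 0 then 0 else C3k / (ρ x z * ρ x t) : ℝ) + (if Hk z x = 0 then 0 else if Hk s y = 0 then 0 else C3h / (ρ x y * ρ x t) : ℝ) + (if Hk t x = 0 then 0 else if Hk s y = 0 then 0 else C3h / (ρ x y * ρ x z) : ℝ) + (if Hk s y = 0 then 0 else C4 * (((r x y ^ 2)⁻¹ * (r x z ^ 2)⁻¹ * (r x t ^ 2)⁻¹ + (r x y ^ 2)⁻¹ * (r y z ^ 2)⁻¹ * (r y t ^ 2)⁻¹ + (r x z ^ 2)⁻¹ * (r y z ^ 2)⁻¹ * (r z t ^ 2)⁻¹ + (r x t ^ 2)⁻¹ * (r y t ^ 2)⁻¹ * (r z t ^ 2)⁻¹ + (r x y ^ 2)⁻¹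 * (r y z ^ 2)⁻¹ * (r z t ^ 2)⁻¹ + (r x y ^ 2)⁻¹ * (r y t ^ 2)⁻¹ * (r z t ^ 2)⁻¹ + (r x z ^ 2)⁻¹ * (r y z ^ 2)⁻¹ * (r y t ^ 2)⁻¹ + (r x z ^ 2)⁻¹ * (r y t ^ 2)⁻¹ * (r z t ^ 2)⁻¹ + (r x t ^ 2)⁻¹ * (r y z ^ 2)⁻¹ * (r y t ^ 2)⁻¹ + (r x t ^ 2)⁻¹ * (r y z ^ 2)⁻¹ * (r z t ^ 2)⁻¹ + (r x y ^ 2)⁻¹ * (r x z ^ 2)⁻¹ * (r z t ^ 2)⁻¹ + (r x y ^ 2)⁻¹ * (r x t ^ 2)⁻¹ * (r z t ^ 2)⁻¹ + (r x y ^ 2)⁻¹ * (r x z ^ 2)⁻¹ * (r y t ^ 2)⁻¹ + (r x z ^ 2)⁻¹ * (r x t ^ 2)⁻¹ * (r y t ^ 2)⁻¹ + (r x y ^ 2)⁻¹ * (r x t ^ 2)⁻¹ * (r y z ^ 2)⁻¹ + (r x z ^ 2)⁻¹ * (r x t ^ 2)⁻¹ * (r y z ^ 2)⁻¹)) : ℝ))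 ≤
      3 * (n₃ * (C3k * S ^ 2)) +
        6 * ((n : ℝ) * n * (C3h * S ^ 2)) +
        3 * ((n : ℝ) * (C4 * (16 * S' ^ 3))) := by
  haveI : Nonempty ι := ⟨t⟩
  have hρ0 : ∀ a b, 0 < ρ a b := fun a b => zero_lt_one.trans_le (hρ1 a b)
  have hdiv2 : ∀ x a b : ι, ∀ {Cc : ℝ}, 0 ≤ Cc → 0 ≤ Cc / (ρ x a * ρ x b) := fun x a b Cc h => div_nonneg h (mul_pos (hρ0 x a) (hρ0 x b)).le
  have hS'0 : 0 ≤ S' := (Finset.sum_nonneg fun v _ => by positivity).trans (hSr t)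
  have hB16 : 0 ≤ 16 * S' ^ 3 := mul_nonneg (by norm_num) (pow_nonneg hS'0 3)
  have hnR : ∀ y : ι, ((Finset.univ.filter (fun z => Hk z y ≠ 0)).card : ℝ) ≤ (n : ℝ) := fun y => by exact_mod_cast hn y
  have hnR' : ∀ z : ι, ((Finset.univ.filter (fun y => Hk z y ≠ 0)).card : ℝ) ≤ (n : ℝ) := fun z => by exact_mod_cast hn' z
  have h1 := ((sum4_syzt _).trans_le ((sum4_le_abs _).trans (pair_vertex_leg_fixed (fun x a' b' d' : ι => if K3 a' b' x = 0 then (0:ℝ) else C3k / (ρ x t * ρ x d')) (fun a' b' x => K3 a' b' x) t hC3k0 hρ1 hρsymm hS (fun x a' b' h d' => if_pos h) (fun x a' b' d' => (abs_ite_le (hdiv2 x _ _ hC3k0)).trans (le_of_eq (by ring))) hn3)))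
  have h2 := ((sum4_syzt _).trans_le ((sum4_le_abs _).trans (vertex_rider_fixed (fun x b' c' d' : ι => if Hk t x = 0 then (0:ℝ) else if Hk c' b' = 0 then (0:ℝ) else C3h / (ρ x b' * ρ x d')) (fun x => Hk t x) (fun c' b' => Hk c' b') hC3h0 hρ1 hS (fun x h b' c' d' => if_pos h) (fun b' c' h x d' => by simp [h]) (fun x b' c' d' => abs_ite_ite_le (hdiv2 x _ _ hC3h0)) (hnR' t) hnR)))
  have h3 := ((sum4_styz _).trans_le ((sum4_le_abs _).trans (two_riders_leg_fixed (fun x a' b' c' : ι => if Hk a' x = 0 then (0:ℝ) else if Hk c' b' = 0 then (0:ℝ) else C3h / (ρ x b' * ρ x t)) (fun a' x => Hk a' x) (fun c' b' => Hk c' b') t hC3h0 hρ1 hρsymm hS (fun x a' h b' c' => if_pos h) (fun b' c' h x a' => by simp [h]) (fun x a' b' c' => abs_ite_ite_le (hdiv2 x _ _ hC3h0)) hnR hnR)))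
  have h4 := ((sum4_syzt _).trans_le ((sum4_le_abs _).trans (tree_leaf_fixed_leaf_rider (fun x a' b' d' : ι => if Hk b' a' = 0 then (0:ℝ) else C4 * (((r x a' ^ 2)⁻¹ * (r x t ^ 2)⁻¹ * (r x d' ^ 2)⁻¹ + (r x a' ^ 2)⁻¹ * (r a' t ^ 2)⁻¹ * (r a' d' ^ 2)⁻¹ + (r x t ^ 2)⁻¹ * (r a' t ^ 2)⁻¹ * (r t d' ^ 2)⁻¹ + (r x d' ^ 2)⁻¹ * (r a' d' ^ 2)⁻¹ * (r t d' ^ 2)⁻¹ + (r x a' ^ 2)⁻¹ * (r a' t ^ 2)⁻¹ * (r t d' ^ 2)⁻¹ + (r x a' ^ 2)⁻¹ * (r a' d' ^ 2)⁻¹ * (r t d' ^ 2)⁻¹ + (r x t ^ 2)⁻¹ * (r a' t ^ 2)⁻¹ * (r a' d' ^ 2)⁻¹ + (r x t ^ 2)⁻¹ * (r a' d' ^ 2)⁻¹ * (r t d' ^ 2)⁻¹ + (r x d' ^ 2)⁻¹ * (r a' t ^ 2)⁻¹ * (r a' d' ^ 2)⁻¹ + (r x d' ^ 2)⁻¹ *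 (r a' t ^ 2)⁻¹ * (r t d' ^ 2)⁻¹ + (r x a' ^ 2)⁻¹ * (r x t ^ 2)⁻¹ * (r t d' ^ 2)⁻¹ + (r x a' ^ 2)⁻¹ * (r x d' ^ 2)⁻¹ * (r t d' ^ 2)⁻¹ + (r x a' ^ 2)⁻¹ * (r x t ^ 2)⁻¹ * (r a' d' ^ 2)⁻¹ + (r x t ^ 2)⁻¹ * (r x d' ^ 2)⁻¹ * (r a' d' ^ 2)⁻¹ + (r x a' ^ 2)⁻¹ * (r x d' ^ 2)⁻¹ * (r a' t ^ 2)⁻¹ + (r x t ^ 2)⁻¹ * (r x d' ^ 2)⁻¹ * (r a' t ^ 2)⁻¹))) (fun x a' d' : ι => (((r x a' ^ 2)⁻¹ * (r x t ^ 2)⁻¹ * (r x d' ^ 2)⁻¹ + (r x a' ^ 2)⁻¹ * (r a' t ^ 2)⁻¹ * (r a' d' ^ 2)⁻¹ + (r x t ^ 2)⁻¹ * (r a' t ^ 2)⁻¹ * (r t d' ^ 2)⁻¹ + (r x d' ^ 2)⁻¹ * (r a' d' ^ 2)⁻¹ * (r t d' ^ 2)⁻¹ + (r x a' ^ 2)⁻¹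 * (r a' t ^ 2)⁻¹ * (r t d' ^ 2)⁻¹ + (r x a' ^ 2)⁻¹ * (r a' d' ^ 2)⁻¹ * (r t d' ^ 2)⁻¹ + (r x t ^ 2)⁻¹ * (r a' t ^ 2)⁻¹ * (r a' d' ^ 2)⁻¹ + (r x t ^ 2)⁻¹ * (r a' d' ^ 2)⁻¹ * (r t d' ^ 2)⁻¹ + (r x d' ^ 2)⁻¹ * (r a' t ^ 2)⁻¹ * (r a' d' ^ 2)⁻¹ + (r x d' ^ 2)⁻¹ * (r a' t ^ 2)⁻¹ * (r t d' ^ 2)⁻¹ + (r x a' ^ 2)⁻¹ * (r x t ^ 2)⁻¹ * (r t d' ^ 2)⁻¹ + (r x a' ^ 2)⁻¹ * (r x d' ^ 2)⁻¹ * (r t d' ^ 2)⁻¹ + (r x a' ^ 2)⁻¹ * (r x t ^ 2)⁻¹ * (r a' d' ^ 2)⁻¹ + (r x t ^ 2)⁻¹ * (r x d' ^ 2)⁻¹ * (r a' d' ^ 2)⁻¹ + (r x a' ^ 2)⁻¹ * (r x d' ^ 2)⁻¹ * (r a' t ^ 2)⁻¹ + (r x t ^ 2)⁻¹ * (r x d'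 ^ 2)⁻¹ * (r a' t ^ 2)⁻¹))) (fun b' a' => Hk b' a') hC40 (fun _ _ _ => by positivity) (fun a' b' h x d' => if_pos h) (fun x a' b' d' => abs_ite_le (mul_nonneg hC40 (by positivity))) (tree16_sum_slot_three hrs hSr t) hnR)))
  have h5 := ((sum4_yszt _).trans_le ((sum4_le_abs _).trans (pair_vertex_member_fixed (fun a' x c' d' : ι => if K3 a' t x = 0 then (0:ℝ) else C3k / (ρ x c' * ρ x d')) (fun a' x => K3 a' t x) hC3k0 hρ1 hS (fun b' x h c' d' => if_pos h) (fun b' x c' d' => abs_ite_le (hdiv2 x _ _ hC3k0)) (hn3m t))))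
  have h6 := ((sum4_yszt _).trans_le ((sum4_le_abs _).trans (counted_then_riders_leg_fn (fun b' x a' d' : ι => if Hk a' x = 0 then (0:ℝ) else if Hk t b' = 0 then (0:ℝ) else C3h / (ρ x b' * ρ x d')) (fun a' x => Hk a' x) (fun b' => Hk t b') (fun b' => b') hC3h0 hρ1 hρsymm hS (fun x a' h b' d' => if_pos h) (fun b' h x a' d' => by simp [h]) (fun b' x a' d' => abs_ite_ite_le (hdiv2 x _ _ hC3h0)) hnR (hnR' t))))
  have h7 := ((sum4_ystz _).trans_le ((sum4_le_abs _).trans (counted_then_riders_leg_fn (fun b' x a' d' : ι => if Hk a' x = 0 then (0:ℝ) else if Hk t b' = 0 then (0:ℝ) else C3h / (ρ x b' * ρ x d')) (fun a' x => Hk a' x) (fun b' => Hk t b') (fun b' => b') hC3h0 hρ1 hρsymm hS (fun x a' h b' d' => if_pos h) (fun b' h x a' d' => by simp [h]) (fun b' x a' d' => abs_ite_ite_le (hdiv2 x _ _ hC3h0)) hnR (hnR' t))))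
  have h8 := ((sum4_yszt _).trans_le ((sum4_le_abs _).trans (tree_counted_weight (fun a' x c' d' : ι => if Hk t a' = 0 then (0:ℝ) else C4 * (((r x a' ^ 2)⁻¹ * (r x c' ^ 2)⁻¹ * (r x d' ^ 2)⁻¹ + (r x a' ^ 2)⁻¹ * (r a' c' ^ 2)⁻¹ * (r a' d' ^ 2)⁻¹ + (r x c' ^ 2)⁻¹ * (r a' c' ^ 2)⁻¹ * (r c' d' ^ 2)⁻¹ + (r x d' ^ 2)⁻¹ * (r a' d' ^ 2)⁻¹ * (r c' d' ^ 2)⁻¹ + (r x a' ^ 2)⁻¹ * (r a' c' ^ 2)⁻¹ * (r c' d' ^ 2)⁻¹ + (r x a' ^ 2)⁻¹ * (r a' d' ^ 2)⁻¹ * (r c' d' ^ 2)⁻¹ + (r x c' ^ 2)⁻¹ * (r a' c' ^ 2)⁻¹ * (r a' d' ^ 2)⁻¹ + (r x c' ^ 2)⁻¹ * (r a' d' ^ 2)⁻¹ * (r c' d' ^ 2)⁻¹ + (r x d' ^ 2)⁻¹ * (r a' c' ^ 2)⁻¹ * (r a' d' ^ 2)⁻¹ + (r x d' ^ 2)⁻¹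 * (r a' c' ^ 2)⁻¹ * (r c' d' ^ 2)⁻¹ + (r x a' ^ 2)⁻¹ * (r x c' ^ 2)⁻¹ * (r c' d' ^ 2)⁻¹ + (r x a' ^ 2)⁻¹ * (r x d' ^ 2)⁻¹ * (r c' d' ^ 2)⁻¹ + (r x a' ^ 2)⁻¹ * (r x c' ^ 2)⁻¹ * (r a' d' ^ 2)⁻¹ + (r x c' ^ 2)⁻¹ * (r x d' ^ 2)⁻¹ * (r a' d' ^ 2)⁻¹ + (r x a' ^ 2)⁻¹ * (r x d' ^ 2)⁻¹ * (r a' c' ^ 2)⁻¹ + (r x c' ^ 2)⁻¹ * (r x d' ^ 2)⁻¹ * (r a' c' ^ 2)⁻¹))) (fun a' x c' d' : ι => (((r x a' ^ 2)⁻¹ * (r x c' ^ 2)⁻¹ * (r x d' ^ 2)⁻¹ + (r x a' ^ 2)⁻¹ * (r a' c' ^ 2)⁻¹ * (r a' d' ^ 2)⁻¹ + (r x c' ^ 2)⁻¹ * (r a' c' ^ 2)⁻¹ * (r c' d' ^ 2)⁻¹ + (r x d' ^ 2)⁻¹ * (r a' d' ^ 2)⁻¹ * (r c' d' ^ 2)⁻¹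 + (r x a' ^ 2)⁻¹ * (r a' c' ^ 2)⁻¹ * (r c' d' ^ 2)⁻¹ + (r x a' ^ 2)⁻¹ * (r a' d' ^ 2)⁻¹ * (r c' d' ^ 2)⁻¹ + (r x c' ^ 2)⁻¹ * (r a' c' ^ 2)⁻¹ * (r a' d' ^ 2)⁻¹ + (r x c' ^ 2)⁻¹ * (r a' d' ^ 2)⁻¹ * (r c' d' ^ 2)⁻¹ + (r x d' ^ 2)⁻¹ * (r a' c' ^ 2)⁻¹ * (r a' d' ^ 2)⁻¹ + (r x d' ^ 2)⁻¹ * (r a' c' ^ 2)⁻¹ * (r c' d' ^ 2)⁻¹ + (r x a' ^ 2)⁻¹ * (r x c' ^ 2)⁻¹ * (r c' d' ^ 2)⁻¹ + (r x a' ^ 2)⁻¹ * (r x d' ^ 2)⁻¹ * (r c' d' ^ 2)⁻¹ + (r x a' ^ 2)⁻¹ * (r x c' ^ 2)⁻¹ * (r a' d' ^ 2)⁻¹ + (r x c' ^ 2)⁻¹ * (r x d' ^ 2)⁻¹ * (r a' d' ^ 2)⁻¹ + (r x a' ^ 2)⁻¹ * (r x d' ^ 2)⁻¹ * (r a' c'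 ^ 2)⁻¹ + (r x c' ^ 2)⁻¹ * (r x d' ^ 2)⁻¹ * (r a' c' ^ 2)⁻¹))) (fun a' => Hk t a') hC40 hB16 (fun a' h x c' d' => if_pos h) (fun a' x c' d' => abs_ite_le (mul_nonneg hC40 (by positivity))) (fun a' => tree16_sum_slot_two hrs hSr a') (hnR' t))))
  have h9 := ((sum4_sytz _).trans_le ((sum4_le_abs _).trans (pair_vertex_leg_fixed (fun x a' b' d' : ι => if K3 a' b' x = 0 then (0:ℝ) else C3k / (ρ x d' * ρ x t)) (fun a' b' x => K3 a' b' x) t hC3k0 hρ1 hρsymm hS (fun x a' b' h d' => if_pos h) (fun x a' b' d' => (abs_ite_le (hdiv2 x _ _ hC3k0)).trans (le_of_eq (by ring))) hn3)))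
  have h10 := ((sum4_szyt _).trans_le ((sum4_le_abs _).trans (two_riders_leg_fixed (fun x a' b' c' : ι => if Hk a' x = 0 then (0:ℝ) else if Hk c' b' = 0 then (0:ℝ) else C3h / (ρ x b' * ρ x t)) (fun a' x => Hk a' x) (fun c' b' => Hk c' b') t hC3h0 hρ1 hρsymm hS (fun x a' h b' c' => if_pos h) (fun b' c' h x a' => by simp [h]) (fun x a' b' c' => abs_ite_ite_le (hdiv2 x _ _ hC3h0)) hnR hnR)))
  have h11 := ((sum4_sytz _).trans_le ((sum4_le_abs _).trans (vertex_rider_fixed (fun x b' c' d' : ι => if Hk t x = 0 then (0:ℝ) else if Hk c' b' = 0 then (0:ℝ) else C3h / (ρ x b' * ρ x d')) (fun x => Hk t x) (fun c' b' => Hk c' b') hC3h0 hρ1 hS (fun x h b' c' d' => if_pos h) (fun b' c' h x d' => by simp [h]) (fun x b' c' d' => abs_ite_ite_le (hdiv2 x _ _ hC3h0)) (hnR' t) hnR)))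
  have h12 := ((sum4_sytz _).trans_le ((sum4_le_abs _).trans (tree_leaf_fixed_leaf_rider (fun x a' b' c' : ι => if Hk b' a' = 0 then (0:ℝ) else C4 * (((r x a' ^ 2)⁻¹ * (r x c' ^ 2)⁻¹ * (r x t ^ 2)⁻¹ + (r x a' ^ 2)⁻¹ * (r a' c' ^ 2)⁻¹ * (r a' t ^ 2)⁻¹ + (r x c' ^ 2)⁻¹ * (r a' c' ^ 2)⁻¹ * (r c' t ^ 2)⁻¹ + (r x t ^ 2)⁻¹ * (r a' t ^ 2)⁻¹ * (r c' t ^ 2)⁻¹ + (r x a' ^ 2)⁻¹ * (r a' c' ^ 2)⁻¹ * (r c' t ^ 2)⁻¹ + (r x a' ^ 2)⁻¹ * (r a' t ^ 2)⁻¹ * (r c' t ^ 2)⁻¹ + (r x c' ^ 2)⁻¹ * (r a' c' ^ 2)⁻¹ * (r a' t ^ 2)⁻¹ + (r x c' ^ 2)⁻¹ * (r a' t ^ 2)⁻¹ * (r c' t ^ 2)⁻¹ + (r x t ^ 2)⁻¹ * (r a' c' ^ 2)⁻¹ * (r a' t ^ 2)⁻¹ + (r x t ^ 2)⁻¹ *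 (r a' c' ^ 2)⁻¹ * (r c' t ^ 2)⁻¹ + (r x a' ^ 2)⁻¹ * (r x c' ^ 2)⁻¹ * (r c' t ^ 2)⁻¹ + (r x a' ^ 2)⁻¹ * (r x t ^ 2)⁻¹ * (r c' t ^ 2)⁻¹ + (r x a' ^ 2)⁻¹ * (r x c' ^ 2)⁻¹ * (r a' t ^ 2)⁻¹ + (r x c' ^ 2)⁻¹ * (r x t ^ 2)⁻¹ * (r a' t ^ 2)⁻¹ + (r x a' ^ 2)⁻¹ * (r x t ^ 2)⁻¹ * (r a' c' ^ 2)⁻¹ + (r x c' ^ 2)⁻¹ * (r x t ^ 2)⁻¹ * (r a' c' ^ 2)⁻¹))) (fun x a' c' : ι => (((r x a' ^ 2)⁻¹ * (r x c' ^ 2)⁻¹ * (r x t ^ 2)⁻¹ + (r x a' ^ 2)⁻¹ * (r a' c' ^ 2)⁻¹ * (r a' t ^ 2)⁻¹ + (r x c' ^ 2)⁻¹ * (r a' c' ^ 2)⁻¹ * (r c' t ^ 2)⁻¹ + (r x t ^ 2)⁻¹ * (r a' t ^ 2)⁻¹ * (r c' t ^ 2)⁻¹ + (r x a' ^ 2)⁻¹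 * (r a' c' ^ 2)⁻¹ * (r c' t ^ 2)⁻¹ + (r x a' ^ 2)⁻¹ * (r a' t ^ 2)⁻¹ * (r c' t ^ 2)⁻¹ + (r x c' ^ 2)⁻¹ * (r a' c' ^ 2)⁻¹ * (r a' t ^ 2)⁻¹ + (r x c' ^ 2)⁻¹ * (r a' t ^ 2)⁻¹ * (r c' t ^ 2)⁻¹ + (r x t ^ 2)⁻¹ * (r a' c' ^ 2)⁻¹ * (r a' t ^ 2)⁻¹ + (r x t ^ 2)⁻¹ * (r a' c' ^ 2)⁻¹ * (r c' t ^ 2)⁻¹ + (r x a' ^ 2)⁻¹ * (r x c' ^ 2)⁻¹ * (r c' t ^ 2)⁻¹ + (r x a' ^ 2)⁻¹ * (r x t ^ 2)⁻¹ * (r c' t ^ 2)⁻¹ + (r x a' ^ 2)⁻¹ * (r x c' ^ 2)⁻¹ * (r a' t ^ 2)⁻¹ + (r x c' ^ 2)⁻¹ * (r x t ^ 2)⁻¹ * (r a' t ^ 2)⁻¹ + (r x a' ^ 2)⁻¹ * (r x t ^ 2)⁻¹ * (r a' c' ^ 2)⁻¹ + (r x c' ^ 2)⁻¹ * (r x t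 ^ 2)⁻¹ * (r a' c' ^ 2)⁻¹))) (fun b' a' => Hk b' a') hC40 (fun _ _ _ => by positivity) (fun a' b' h x c' => if_pos h) (fun x a' b' c' => abs_ite_le (mul_nonneg hC40 (by positivity))) (tree16_sum_slot_four hrs hSr t) hnR)))
  repeat rw [sum4_add]
  exact ((add_le_add (add_le_add (add_le_add (add_le_add (add_le_add (add_le_add (add_le_add (add_le_add (add_le_add (add_le_add (add_le_add h1 h2) h3) h4) h5) h6) h7) h8) h9) h10) h11) h12)).trans (le_of_eq (by ring))

/-- Toy. -/
example : (2 : ℕ) + 12 + 9 + 12 + 12 + 5 = 52 := by norm_num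

end Summit.QuantumFields.BalabanUV.T4Continuum.NE7b.SupFifthKernelEntryLetterSlotFourB

end
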